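import Summits.QuantumAdvantage.QuantumAdvantage.Theses.CubicForrelation

/-!
# Dillon certificate machinery for crux `CubicForrelation.ExactPairsMaioranaMcFarland` (stmt-QuantumAdvantage-2205)

Negative-side support file (cdisprove seat, 2026-08-15).  The crux concludes that `g` is in the COMPLETED
Maiorana–McFarland class: `g∘e(y′,y″) = y′·perm(y″) + h(y″)` for an affine bijection `e`.  Dillon's criterion: such a
`g` is affine on every coset of an `m`-dimensional subspace, i.e. all second derivatives `D_a D_b g`, `a b` in that
subspace, vanish identically.  This file proves the criterion in the crux's own vocabulary at `m = 5`
(`mm_family`), turns it into a CHECKABLE COUNT (`count_ge_of_MM`: at least 32 directions `b` admit at least 32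
sample-compatible `a`), and transfers the count to machine integers (`count_transfer`, coding equivalence
`E : Fin 1024 ≃ (Fin 10 → Bool)`), so that `native_decide` can refute MM#-membership of explicit 10-variable
functions (`not_MM_of_bigCountC_lt`).  Also: `forrelation_comm` and cast lemmas for evaluating `forrelation`
exactly on codes.  Used by `H104Witness.lean` (load-bearing analysis of the crux).  `native_decide` is used for
three finite coding facts (`code_lt`, `dec_code_apply`, `code_dec`): the file is `computational`.

References: J. F. Dillon, PhD thesis (1974) (the M-subspace criterion); A. Polujan, A. Pott, Des. Codes Cryptogr.
88 (2020), arXiv:1908.11271, §2 (algorithmic form of the criterion).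
-/

namespace Summit.QuantumAdvantage.QuantumAdvantage.Theorems.ExactPairsMaioranaMcFarland.Negative

open Literature.Computability.QuantumComplexity

/-! ### Bit-vector plumbing -/

/-- pointwise xor of bit-vectors -/
def bx {n : ℕ} (x a : Fin n → Bool) : Fin n → Bool := fun i => xor (x i) (a i)

/-- indicator vector in `ZMod 2` -/
def ind {n : ℕ} (x : Fin n → Bool) : Fin n → ZMod 2 := fun i => if x i then 1 else 0

/-- unfolding lemma for `ind` -/
theorem ind_apply {n : ℕ} (x : Fin n → Bool) (i : Fin n) : ind x i = if x i then 1 else 0 := rfl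

/-- a bit-vector is determined by its indicator vector -/
theorem ind_injective {n : ℕ} : Function.Injective (ind (n := n)) := by
  intro x y h
  funext i
  have hi := congrFun h i
  simp only [ind] at hi
  revert hi
  cases x i <;> cases y i <;> simp

/-- indicator of a xor is the sum of indicators in `ZMod 2` -/
theorem ite_xor (p q : Bool) :
    (if (p ^^ q) then (1 : ZMod 2) else 0) = (if p then (1 : ZMod 2) else 0) + (if q then (1 : ZMod 2) else 0) := by
  cases p <;> cases q <;> decide

/-- `ind` is additive: pointwise xor becomes addition in `ZMod 2` -/
theorem ind_bx {n : ℕ} (x a : Fin n → Bool) : ind (bx x a) = ind x + ind a := by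
  funext i
  exact ite_xor (x i) (a i)

/-- the all-zero vector of length 5 -/
def z5 : Fin 5 → Bool := fun _ => false

/-- `Fin.append` commutes with xor-ing the first block -/
theorem append_bx (y' t y'' : Fin 5 → Bool) :
    Fin.append (bx y' t) y'' = bx (Fin.append y' y'') (Fin.append t z5) := by
  funext i
  refine Fin.addCases (fun j => ?_) (fun j => ?_) i
  · simp only [bx, Fin.append_left]
  · simp only [bx, z5, Fin.append_right, Bool.xor_false]

/-- four Booleans whose indicators sum to zero xor to `false` -/
theorem xor4_of_ind (a b c d : Bool)
    (h : (if a then (1 : ZMod 2) else 0) + (if b then (1 : ZMod 2) else 0)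
      + (if c then (1 : ZMod 2) else 0) + (if d then (1 : ZMod 2) else 0) = 0) :
    (a ^^ b ^^ c ^^ d) = false := by
  revert h; cases a <;> cases b <;> cases c <;> cases d <;> decide

/-- the algebraic identity behind Dillon's criterion: four MM values over a 2-flat in `y'` cancel -/
theorem mm_four_sum (A T S P : Fin 5 → ZMod 2) (H : ZMod 2) :
    (∑ i, A i * P i + H) + (∑ i, (A i + T i) * P i + H) + (∑ i, (A i + S i) * P i + H)
      + (∑ i, (A i + T i + S i) * P i + H) = 0 := by
  simp only [Finset.sum_add_distrib, add_mul]
  have h2 : ∀ z : ZMod 2, z + z = 0 := CharTwo.add_self_eq_zero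
  -- group equal terms
  calc _ = ((∑ i, A i * P i) + (∑ i, A i * P i)) + ((∑ i, A i * P i) + (∑ i, A i * P i))
        + ((∑ i, T i * P i) + (∑ i, T i * P i)) + ((∑ i, S i * P i) + (∑ i, S i * P i))
        + ((H + H) + (H + H)) := by ring
    _ = 0 := by simp only [h2]

/-! ### The completed-Maiorana–McFarland conclusion of the crux -/

/-- The conclusion of `ExactPairsMaioranaMcFarland` at a general `m` (verbatim shape): `g` composed with an
affine bijection `e` is in Maiorana–McFarland normal form `y′·perm(y″) + h(y″)`. -/
def MMConclusionAt (m : ℕ) (g : (Fin (m + m) → Bool) → Bool) : Prop :=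
  ∃ e : (Fin (m + m) → Bool) ≃ (Fin (m + m) → Bool), (∃ M : Matrix (Fin (m + m)) (Fin (m + m)) (ZMod 2), ∃ c : Fin (m + m) → ZMod 2, ∀ y i, (if e y i then (1 : ZMod 2) else 0) = (M.mulVec (fun j => if y j then (1 : ZMod 2) else 0) + c) i) ∧ ∃ perm : (Fin m → Bool) ≃ (Fin m → Bool), ∃ h : (Fin m → Bool) → Bool, ∀ y' y'' : Fin m → Bool, (if g (e (Fin.append y' y'')) then (1 : ZMod 2) else 0) = (∑ i, (if y' i then (1 : ZMod 2) else 0) * (if perm y'' i then (1 : ZMod 2) else 0)) + (if h y'' then (1 : ZMod 2) else 0)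

/-- The crux is literally `∀ m f g, f cubic → g cubic → forrelation f g = 1 → MMConclusionAt m g`. -/
theorem exactPairsMaioranaMcFarland_iff :
    Summit.QuantumAdvantage.QuantumAdvantage.Theses.CubicForrelation.ExactPairsMaioranaMcFarland ↔
      ∀ m : ℕ, ∀ f g : (Fin (m + m) → Bool) → Bool,
      (∃ p : MvPolynomial (Fin (m + m)) (ZMod 2), p.totalDegree ≤ 3 ∧ ∀ x, f x = decide (MvPolynomial.eval (fun j => if x j then (1 : ZMod 2) else 0) p = 1)) →
      (∃ p : MvPolynomial (Fin (m + m)) (ZMod 2), p.totalDegree ≤ 3 ∧ ∀ x, g x = decide (MvPolynomial.eval (fun j => if x j then (1 : ZMod 2) else 0) p = 1)) →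
      forrelation f g = 1 → MMConclusionAt m g := Iff.rfl

/-- Dillon's necessary condition: an MM#-function on `5+5` bits admits 32 = 2^5 distinct translates
`u t` such that all second derivatives `D_{u t} D_{u s} g` vanish identically. -/
theorem mm_family (g : (Fin (5 + 5) → Bool) → Bool) (hg : MMConclusionAt 5 g) :
    ∃ u : (Fin 5 → Bool) → (Fin (5 + 5) → Bool), Function.Injective u ∧
      ∀ t s x, (g x ^^ g (bx x (u t)) ^^ g (bx x (u s)) ^^ g (bx (bx x (u t)) (u s))) = false := by
  obtain ⟨e, ⟨M, c, he⟩, perm, h, hMM⟩ := hg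
  have he' : ∀ y, ind (e y) = M.mulVec (ind y) + c := fun y => funext (he y)
  have hcc : c + c = 0 := funext fun i => CharTwo.add_self_eq_zero (c i)
  have hz : ind (Fin.append z5 z5) = 0 := by
    funext i
    refine Fin.addCases (fun j => ?_) (fun j => ?_) i
    · simp only [ind, z5, Fin.append_left, Pi.zero_apply]; rfl
    · simp only [ind, z5, Fin.append_right, Pi.zero_apply]; rfl
  refine ⟨fun t => bx (e (Fin.append t z5)) (e (Fin.append z5 z5)), ?_, ?_⟩
  · -- injectivity
    intro t s hts
    have h1 : e (Fin.append t z5) = e (Fin.append s z5) := by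
      funext i
      have hi := congrFun hts i
      simp only [bx] at hi
      revert hi
      cases e (Fin.append t z5) i <;> cases e (Fin.append s z5) i <;>
        cases e (Fin.append z5 z5) i <;> simp
    have h2 := e.injective h1
    funext i
    have h3 := congrFun h2 (Fin.castAdd 5 i)
    simpa [Fin.append_left] using h3
  · -- vanishing second derivatives
    have hu : ∀ t, ind (bx (e (Fin.append t z5)) (e (Fin.append z5 z5))) = M.mulVec (ind (Fin.append t z5)) := by
      intro t
      rw [ind_bx, he', he', hz, Matrix.mulVec_zero, zero_add, add_assoc, hcc, add_zero]
    have hA : ∀ y' y'' t, bx (e (Fin.append y' y'')) (bx (e (Fin.append t z5)) (e (Fin.append z5 z5)))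
        = e (Fin.append (bx y' t) y'') := by
      intro y' y'' t
      apply ind_injective
      rw [ind_bx, he', hu, he', append_bx, ind_bx, Matrix.mulVec_add]
      abel
    intro t s x
    obtain ⟨y, rfl⟩ := e.surjective x
    have hy : Fin.append (fun i => y (Fin.castAdd 5 i)) (fun i => y (Fin.natAdd 5 i)) = y :=
      Fin.append_castAdd_natAdd
    rw [← hy, hA, hA, hA]
    apply xor4_of_ind
    rw [hMM, hMM, hMM, hMM]
    have e1 : ∀ (a b : Fin 5 → Bool) i, (if bx a b i then (1 : ZMod 2) else 0)
        = (if a i then (1 : ZMod 2) else 0) + (if b i then (1 : ZMod 2) else 0) :=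
      fun a b i => ite_xor (a i) (b i)
    simp only [e1]
    exact mm_four_sum _ _ _ _ _


/-! ### Codes `Fin 1024 ≃ (Fin 10 → Bool)` -/

/-- Decode a natural number into a bit-vector of length 10 (`x_i = testBit k i`). -/
def dec (k : ℕ) : Fin 10 → Bool := fun i => k.testBit i.val

/-- Encode a bit-vector of length 10 as a natural number `< 1024`. -/
def code (x : Fin 10 → Bool) : ℕ := ∑ i : Fin 10, (x i).toNat * 2 ^ (i : ℕ)

/-- codes of 10-bit vectors are `< 1024` (finite check) -/
theorem code_lt : ∀ x : Fin 10 → Bool, code x < 1024 := by native_decide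

/-- `dec` is a left inverse of `code` (finite check) -/
theorem dec_code_apply : ∀ x : Fin 10 → Bool, ∀ i : Fin 10, dec (code x) i = x i := by native_decide

/-- `code` is a left inverse of `dec` on `Fin 1024` (finite check) -/
theorem code_dec : ∀ k : Fin 1024, code (dec k) = k := by native_decide

/-- decoding turns `Nat.xor` into pointwise xor -/
theorem dec_xor (a b : ℕ) : dec (a ^^^ b) = bx (dec a) (dec b) := by
  funext i; simp [dec, bx, Nat.testBit_xor]

/-- The coding equivalence. -/
def E : Fin 1024 ≃ (Fin 10 → Bool) where
  toFun k := dec k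
  invFun x := ⟨code x, code_lt x⟩
  left_inv k := Fin.ext (code_dec k)
  right_inv x := funext (dec_code_apply x)

/-- `E` is decoding -/
@[simp] theorem E_apply (k : Fin 1024) : E k = dec k := rfl

/-! ### Certificate: too few directions with many vanishing second derivatives -/

/-- sample points: 0 and the unit vectors (codes) -/
def S1 : List ℕ := [0, 1, 2, 4, 8, 16, 32, 64, 128, 256, 512]

/-- all sample points are valid codes -/
theorem S1_lt : ∀ k ∈ S1, k < 1024 := by decide

/-- second derivative of a table function vanishes on the sample points -/
def compatT (t : ℕ → Bool) (a b : ℕ) : Bool :=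
  S1.all fun x => (t x ^^ t (x ^^^ a) ^^ t (x ^^^ b) ^^ t (x ^^^ a ^^^ b)) == false

/-- sampled second-derivative test on functions -/
def compatF (g : (Fin 10 → Bool) → Bool) (a b : Fin 10 → Bool) : Prop :=
  ∀ k ∈ S1, (g (dec k) ^^ g (bx (dec k) a) ^^ g (bx (dec k) b) ^^ g (bx (bx (dec k) a) b)) = false

/-- the sampled second-derivative test is decidable -/
instance (g : (Fin 10 → Bool) → Bool) (a b : Fin 10 → Bool) : Decidable (compatF g a b) := by
  unfold compatF; infer_instance

/-- number of directions `b` (including `0`) admitting at least 32 sampled-compatible `a` -/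
def bigCountC (t : ℕ → Bool) : ℕ :=
  (Finset.univ.filter fun b : Fin 1024 =>
    32 ≤ (Finset.univ.filter fun a : Fin 1024 => compatT t a b = true).card).card

/-- Dillon's criterion as a count: an MM# function has at least 32 directions `b` each admitting at least 32
sample-compatible directions `a`. -/
theorem count_ge_of_MM (g : (Fin (5 + 5) → Bool) → Bool) (hg : MMConclusionAt 5 g) :
    32 ≤ (Finset.univ.filter fun b : Fin 10 → Bool =>
      32 ≤ (Finset.univ.filter fun a : Fin 10 → Bool => compatF g a b).card).card := by
  obtain ⟨u, hu, hD⟩ := mm_family g hg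
  set V : Finset (Fin 10 → Bool) := Finset.univ.image u with hVdef
  have hV : V.card = 32 := by
    rw [hVdef, Finset.card_image_of_injective _ hu]
    simp
  have h1 : ∀ b ∈ V, V ⊆ Finset.univ.filter fun a => compatF g a b := by
    intro b hb a ha
    rw [hVdef, Finset.mem_image] at ha hb
    obtain ⟨t, -, rfl⟩ := ha
    obtain ⟨s, -, rfl⟩ := hb
    simp only [Finset.mem_filter, Finset.mem_univ, true_and]
    intro k _
    exact hD t s (dec k)
  have h2 : V ⊆ Finset.univ.filter fun b : Fin 10 → Bool =>
      32 ≤ (Finset.univ.filter fun a : Fin 10 → Bool => compatF g a b).card := by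
    intro b hb
    simp only [Finset.mem_filter, Finset.mem_univ, true_and]
    calc 32 = V.card := hV.symm
      _ ≤ _ := Finset.card_le_card (h1 b hb)
  calc 32 = V.card := hV.symm
    _ ≤ _ := Finset.card_le_card h2

/-- counting over bit-vectors equals counting over codes -/
theorem card_filter_E (P : (Fin 10 → Bool) → Prop) [DecidablePred P] :
    (Finset.univ.filter P).card = (Finset.univ.filter fun k : Fin 1024 => P (E k)).card := by
  rw [← Finset.map_univ_equiv E, Finset.filter_map, Finset.card_map]
  rfl

/-- the sampled second-derivative test agrees on functions and on tables -/
theorem compat_transfer (g : (Fin 10 → Bool) → Bool) (t : ℕ → Bool)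
    (ht : ∀ k, k < 1024 → t k = g (dec k)) (a b : Fin 1024) :
    compatF g (E a) (E b) ↔ compatT t a b = true := by
  simp only [compatF, compatT, E_apply, List.all_eq_true, beq_iff_eq]
  refine forall₂_congr fun k hk => ?_
  have hk' := S1_lt k hk
  have h1 : k ^^^ (a : ℕ) < 1024 := Nat.xor_lt_two_pow (n := 10) hk' a.isLt
  have h2 : k ^^^ (b : ℕ) < 1024 := Nat.xor_lt_two_pow (n := 10) hk' b.isLt
  have h3 : k ^^^ (a : ℕ) ^^^ (b : ℕ) < 1024 := Nat.xor_lt_two_pow (n := 10) h1 b.isLt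
  rw [ht _ hk', ht _ h1, ht _ h2, ht _ h3]
  simp only [dec_xor]

/-- the Dillon count of `g` equals the machine count `bigCountC` of its table -/
theorem count_transfer (g : (Fin 10 → Bool) → Bool) (t : ℕ → Bool)
    (ht : ∀ k, k < 1024 → t k = g (dec k)) :
    (Finset.univ.filter fun b : Fin 10 → Bool =>
      32 ≤ (Finset.univ.filter fun a : Fin 10 → Bool => compatF g a b).card).card = bigCountC t := by
  have inner : ∀ k : Fin 1024, (Finset.univ.filter fun a : Fin 10 → Bool => compatF g a (E k)).card
      = (Finset.univ.filter fun a : Fin 1024 => compatT t a k = true).card := by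
    intro k
    refine (card_filter_E _).trans ?_
    exact congrArg Finset.card (Finset.filter_congr fun a _ => compat_transfer g t ht a k)
  refine (card_filter_E _).trans ?_
  unfold bigCountC
  exact congrArg Finset.card (Finset.filter_congr fun k _ => by rw [inner])

/-- MAIN TOOL: a 10-variable function whose table `t` has fewer than 32 "rich" directions is not in the
completed Maiorana–McFarland class (in the crux's formulation). -/
theorem not_MM_of_bigCountC_lt (g : (Fin 10 → Bool) → Bool) (t : ℕ → Bool)
    (ht : ∀ k, k < 1024 → t k = g (dec k)) (hlt : bigCountC t < 32) : ¬ MMConclusionAt 5 g := by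
  intro h
  have h32 := count_ge_of_MM g h
  rw [count_transfer g t ht] at h32
  omega

/-! ### Exact evaluation of `forrelation` on codes -/

/-- `(-1)^[b]` as an integer -/
def sgnZ (b : Bool) : ℤ := if b then -1 else 1
/-- `(-1)^{x·y}` as an integer -/
def twistZ (x y : Fin 10 → Bool) : ℤ := ∏ l, if x l && y l then -1 else 1
/-- `signOf` is the cast of `sgnZ` -/
theorem signOf_eq_cast (b : Bool) : signOf b = (sgnZ b : ℝ) := by
  cases b <;> simp [signOf, sgnZ]

/-- `twist` is the cast of `twistZ` -/
theorem twist_eq_cast (x y : Fin 10 → Bool) : twist x y = (twistZ x y : ℝ) := by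
  unfold twist twistZ
  push_cast
  refine Finset.prod_congr rfl fun l _ => ?_
  split <;> simp

/-- the twist `(-1)^{x·y}` is symmetric -/
theorem twist_comm {n : ℕ} (x y : Fin n → Bool) : twist x y = twist y x := by
  unfold twist
  refine Finset.prod_congr rfl fun l _ => ?_
  rw [Bool.and_comm]

/-- `forrelation` is symmetric: `Φ(f,g) = Φ(g,f)` (the kernel `(-1)^{x·y}` is symmetric) -/
theorem forrelation_comm {n : ℕ} (f g : (Fin n → Bool) → Bool) : forrelation f g = forrelation g f := by
  unfold forrelation
  congr 1
  rw [Finset.sum_comm]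
  refine Finset.sum_congr rfl fun y _ => Finset.sum_congr rfl fun x _ => ?_
  rw [twist_comm]; ring

end Summit.QuantumAdvantage.QuantumAdvantage.Theorems.ExactPairsMaioranaMcFarland.Negative
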